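import Summits.Ventures.PercRepro.RankLevelSetExplicitArithB

/-!
# PercRepro — THE ARITHMETIC OF THEOREM P‴: THE POLYNOMIAL INEQUALITY `(P_d)` WITH THE NULLITY CAP AT EVERY CORANK
`q + 1 ≤ d ≤ q + 2^q`, FOR `p ≥ Tcap q = (q + 2)·2^{2q+6}` (p9, S4)

`proofs/SUBCLAIM-S4-p9.md` §S4.2″. With p8's nullity cap both fibre sums of night-1's split count are `≤ 2^{d−1}` at
every corank; the circuit sums `Σ_{k=3}^{q+1} C(d+k−1, k)·C(n, q+1−k)` are bounded through Vandermonde by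
`C(d+q, 3)·C(n+d+q−3, q−2)` (`circuit_sum_le_vandermonde`); the small class needs `(p+1)² ≳ 2^{4q+11}·q²`
(`small_term_bound`: the ratio bound `choose_mul_pow_le_choose_mul_pow`, Bernoulli `add_pow_mul_le_pow_mul` and
`choose_two_down` of RankLevelSetExplicitArithA/B), the big class `(p+1)^q ≳ 2^{q²+4q+6}·(q+2)^{q−2}·q^q`
(`big_term_bound`, through `(p+1)^q ≤ q!·C(p+q, q)`); both hold from `p ≥ Tcap q`, and `poly_main_cap` assembles
`8·(C(n, q) + N) ≤ 7·2^{d−q}·C(p+q, q)` for every `N ≤ 2^{d−1}·C(d+q, 3)·(C(p+2d+q−3, q−2) + C((q+2)d+q−3, q−2))`.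
Mathlib only beyond the two landed arithmetic modules. Axioms: standard.
-/

open scoped Matroid

namespace PercRepro

namespace ThmN

open Set

variable {α : Type}

namespace Explicit

/-- **The single-exponential threshold** `Tcap q = (q + 2)·2^{2q+6}`. -/
def Tcap (q : ℕ) : ℕ := (q + 2) * 2 ^ (2 * q + 6)

/-- `2^{2q+6} = 64·(2^q)²`. -/
theorem two_pow_two_mul_add_six (q : ℕ) : 2 ^ (2 * q + 6) = 64 * (2 ^ q * 2 ^ q) := by
  rw [pow_add, mul_comm 2 q, pow_mul]; ring

/-- The regime thresholds below `Tcap q` (`q ≥ 3`): `N₁ q`, `16q·2^q`, `3(2q + 2^q) + 5`, `4q(q + 2^q)`, `q + 3`. -/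
theorem Tcap_bounds (q : ℕ) (hq : 3 ≤ q) :
    2 ^ (q + 1) + 2 * q ^ 2 + 4 * q + 4 ≤ Tcap q ∧ 16 * q * 2 ^ q ≤ Tcap q ∧ 3 * (2 * q + 2 ^ q) + 5 ≤ Tcap q ∧
      4 * q * (q + 2 ^ q) ≤ Tcap q ∧ q + 3 ≤ Tcap q := by
  unfold Tcap
  rw [two_pow_two_mul_add_six, pow_succ]
  have hx : q ≤ 2 ^ q := Nat.lt_two_pow_self.le
  have hx8 : 8 ≤ 2 ^ q := by
    calc 8 = 2 ^ 3 := by norm_num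
      _ ≤ 2 ^ q := Nat.pow_le_pow_right (by norm_num) hq
  refine ⟨?_, ?_, ?_, ?_, ?_⟩ <;> nlinarith

/-- `Tcap` grows: `2·Tcap q ≤ Tcap (q + 1)`. -/
theorem Tcap_le_Tcap_succ (q : ℕ) : 2 * Tcap q ≤ Tcap (q + 1) := by
  unfold Tcap
  have h2 : 2 ^ (2 * q + 6 + 1) ≤ 2 ^ (2 * (q + 1) + 6) := Nat.pow_le_pow_right (by norm_num) (by omega)
  calc 2 * ((q + 2) * 2 ^ (2 * q + 6)) = (q + 2) * 2 ^ (2 * q + 6 + 1) := by ring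
    _ ≤ (q + 1 + 2) * 2 ^ (2 * (q + 1) + 6) := Nat.mul_le_mul (by omega) h2

/-- `C(a, k) ≤ C(a, 3)·C(a − 3, k − 3)` for `k ≥ 3` (`Nat.choose_mul` with `C(k, 3) ≥ 1`). -/
theorem choose_le_choose_three_mul (a k : ℕ) (hk : 3 ≤ k) :
    a.choose k ≤ a.choose 3 * (a - 3).choose (k - 3) := by
  have hm := Nat.choose_mul (n := a) (k := k) (s := 3) hk
  have hpos : 1 ≤ k.choose 3 := Nat.choose_pos hk
  calc a.choose k ≤ a.choose k * k.choose 3 := Nat.le_mul_of_pos_right _ hpos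
    _ = a.choose 3 * (a - 3).choose (k - 3) := hm

/-- **The circuit sum through Vandermonde**: for `q ≥ 2`,
`Σ_{k ∈ [3, q+1]} C(d+k−1, k)·C(n, q+1−k) ≤ C(d+q, 3)·C(d+q−3+n, q−2)`. -/
theorem circuit_sum_le_vandermonde (q d n : ℕ) (hq : 2 ≤ q) :
    ∑ k ∈ Finset.Icc 3 (q + 1), (d + k - 1).choose k * n.choose (q + 1 - k) ≤
      (d + q).choose 3 * (d + q - 3 + n).choose (q - 2) := by
  have h1 : ∀ k ∈ Finset.Icc 3 (q + 1), (d + k - 1).choose k * n.choose (q + 1 - k) ≤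
      (d + q).choose 3 * ((d + q - 3).choose (k - 3) * n.choose (q + 1 - k)) := by
    intro k hk
    rw [Finset.mem_Icc] at hk
    have ha : (d + k - 1).choose k ≤ (d + q).choose k := Nat.choose_le_choose k (by omega)
    have hb := choose_le_choose_three_mul (d + q) k hk.1
    calc (d + k - 1).choose k * n.choose (q + 1 - k)
        ≤ ((d + q).choose 3 * (d + q - 3).choose (k - 3)) * n.choose (q + 1 - k) :=
          Nat.mul_le_mul_right _ (ha.trans hb)
      _ = _ := by ring
  refine (Finset.sum_le_sum h1).trans ?_
  rw [← Finset.mul_sum]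
  apply le_of_eq
  congr 1
  rw [Nat.add_choose_eq, Finset.Nat.sum_antidiagonal_eq_sum_range_succ_mk]
  rw [show Finset.Icc 3 (q + 1) = Finset.image (fun i => 3 + i) (Finset.range (q - 2).succ) from ?_]
  · rw [Finset.sum_image (fun a _ b _ h => by omega)]
    apply Finset.sum_congr rfl
    intro i _
    rw [show 3 + i - 3 = i by omega, show q + 1 - (3 + i) = q - 2 - i by omega]
  · ext k
    simp only [Finset.mem_Icc, Finset.mem_image, Finset.mem_range]
    constructor
    · intro hk
      exact ⟨k - 3, by omega, by omega⟩
    · rintro ⟨i, hi, rfl⟩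
      omega

/-- `d + q ≤ 2^{q+2}` on the bounded-corank range. -/
theorem add_le_two_pow_of_le (q d : ℕ) (hd2 : d ≤ q + 2 ^ q) : d + q ≤ 2 ^ (q + 2) := by
  have hx : q ≤ 2 ^ q := Nat.lt_two_pow_self.le
  rw [pow_add]
  omega

/-- `C(d+q, 3) ≤ 2^{3q+6}` on the bounded-corank range. -/
theorem choose_three_le (q d : ℕ) (hd2 : d ≤ q + 2 ^ q) : (d + q).choose 3 ≤ 2 ^ (3 * q + 6) := by
  calc (d + q).choose 3 ≤ (d + q) ^ 3 := Nat.choose_le_pow _ _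
    _ ≤ (2 ^ (q + 2)) ^ 3 := Nat.pow_le_pow_left (add_le_two_pow_of_le q d hd2) 3
    _ = 2 ^ (3 * q + 6) := by rw [← pow_mul]; congr 1; ring

/-- **The small class**: `2^{q+4}·C(d+q, 3)·C(p+2d+q−3, q−2) ≤ 5·C(p+q, q)` for `p ≥ Tcap q`. -/
theorem small_term_bound (q d p : ℕ) (hq : 3 ≤ q) (hd1 : q + 1 ≤ d) (hd2 : d ≤ q + 2 ^ q) (hp : Tcap q ≤ p) :
    2 ^ (q + 4) * (d + q).choose 3 * (d + q - 3 + (p + d)).choose (q - 2) ≤ 5 * (p + q).choose q := by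
  obtain ⟨-, -, -, h4q, hq3⟩ := Tcap_bounds q hq
  -- (i) `C(p+2d+q−3, q−2) ≤ 2·C(p+q, q−2)`: the ratio bound and Bernoulli
  have hside : 2 * (q - 2) * (2 * d - 3) ≤ p + 3 := by
    have : 2 * (q - 2) * (2 * d - 3) ≤ 4 * q * (q + 2 ^ q) := by
      have h1 : 2 * (q - 2) ≤ 2 * q := by omega
      have h2 : 2 * d - 3 ≤ 2 * (q + 2 ^ q) := by omega
      calc 2 * (q - 2) * (2 * d - 3) ≤ 2 * q * (2 * (q + 2 ^ q)) := Nat.mul_le_mul h1 h2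
        _ = 4 * q * (q + 2 ^ q) := by ring
    omega
  have hC2 : (d + q - 3 + (p + d)).choose (q - 2) ≤ 2 * (p + q).choose (q - 2) := by
    have hr := choose_mul_pow_le_choose_mul_pow (p + 2) (q - 2) (2 * d + q - 5) (by omega)
    rw [show p + 2 + (2 * d + q - 5) = d + q - 3 + (p + d) by omega,
      show p + 2 + (q - 2) = p + q by omega, show p + 2 + 1 + (2 * d + q - 5 - (q - 2)) = p + 3 + (2 * d - 3) by omega,
      show p + 2 + 1 = p + 3 by omega] at hr
    have hb := add_pow_mul_le_pow_mul (p + 3) (2 * d - 3) (q - 2) hside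
    have hpos : 0 < (p + 3) ^ (q - 2) * (p + 3) := Nat.mul_pos (pow_pos (by omega) _) (by omega)
    refine Nat.le_of_mul_le_mul_right ?_ hpos
    calc (d + q - 3 + (p + d)).choose (q - 2) * ((p + 3) ^ (q - 2) * (p + 3))
        = ((d + q - 3 + (p + d)).choose (q - 2) * (p + 3) ^ (q - 2)) * (p + 3) := by ring
      _ ≤ ((p + q).choose (q - 2) * (p + 3 + (2 * d - 3)) ^ (q - 2)) * (p + 3) := Nat.mul_le_mul_right _ hr
      _ = (p + q).choose (q - 2) * ((p + 3 + (2 * d - 3)) ^ (q - 2) * (p + 3)) := by ring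
      _ ≤ (p + q).choose (q - 2) * ((p + 3) ^ (q - 2) * (p + 3 + 2 * (q - 2) * (2 * d - 3))) :=
          Nat.mul_le_mul_left _ hb
      _ ≤ (p + q).choose (q - 2) * ((p + 3) ^ (q - 2) * (2 * (p + 3))) := by
          apply Nat.mul_le_mul_left; apply Nat.mul_le_mul_left; omega
      _ = 2 * (p + q).choose (q - 2) * ((p + 3) ^ (q - 2) * (p + 3)) := by ring
  -- (ii) `p²·C(p+q, q−2) ≤ q(q−1)·C(p+q, q)`
  have hC3 : p ^ 2 * (p + q).choose (q - 2) ≤ q * (q - 1) * (p + q).choose q := by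
    have h := choose_two_down (p + q) (q - 2) (p - 1) (by omega)
    rw [show p - 1 + 1 = p by omega, show q - 2 + 2 = q by omega, show q - 2 + 1 = q - 1 by omega] at h
    exact h
  -- (iii) the constant: `2^{q+5}·C(d+q,3)·q(q−1) ≤ 5p²`
  have hconst : 2 ^ (q + 5) * (d + q).choose 3 * (q * (q - 1)) ≤ 5 * p ^ 2 := by
    have h3 := choose_three_le q d hd2
    have hqq : q * (q - 1) ≤ q * q := Nat.mul_le_mul_left _ (by omega)
    have hT : Tcap q ^ 2 ≤ p ^ 2 := Nat.pow_le_pow_left hp 2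
    have hTsq : Tcap q ^ 2 = (q + 2) ^ 2 * (2 ^ (q + 5) * 2 ^ (3 * q + 6) * 2) := by
      unfold Tcap
      rw [show 2 ^ (q + 5) * 2 ^ (3 * q + 6) * 2 = 2 ^ ((2 * q + 6) * 2) by
        rw [← pow_add, ← pow_succ]; congr 1; ring]
      ring
    calc 2 ^ (q + 5) * (d + q).choose 3 * (q * (q - 1))
        ≤ 2 ^ (q + 5) * 2 ^ (3 * q + 6) * (q * q) := by
          apply Nat.mul_le_mul (Nat.mul_le_mul_left _ h3) hqq
      _ ≤ (q + 2) ^ 2 * (2 ^ (q + 5) * 2 ^ (3 * q + 6) * 2) := by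
          have : q * q ≤ (q + 2) ^ 2 * 2 := by nlinarith
          nlinarith [Nat.zero_le (2 ^ (q + 5) * 2 ^ (3 * q + 6))]
      _ = Tcap q ^ 2 := hTsq.symm
      _ ≤ p ^ 2 := hT
      _ ≤ 5 * p ^ 2 := by omega
  -- assemble: multiply by `p²` and cancel
  have hp0 : 0 < p ^ 2 := pow_pos (by omega) 2
  refine Nat.le_of_mul_le_mul_right ?_ hp0
  calc 2 ^ (q + 4) * (d + q).choose 3 * (d + q - 3 + (p + d)).choose (q - 2) * p ^ 2
      ≤ 2 ^ (q + 4) * (d + q).choose 3 * (2 * (p + q).choose (q - 2)) * p ^ 2 := by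
        apply Nat.mul_le_mul_right; apply Nat.mul_le_mul_left; exact hC2
    _ = 2 ^ (q + 5) * (d + q).choose 3 * (p ^ 2 * (p + q).choose (q - 2)) := by ring
    _ ≤ 2 ^ (q + 5) * (d + q).choose 3 * (q * (q - 1) * (p + q).choose q) := Nat.mul_le_mul_left _ hC3
    _ = (2 ^ (q + 5) * (d + q).choose 3 * (q * (q - 1))) * (p + q).choose q := by ring
    _ ≤ 5 * p ^ 2 * (p + q).choose q := Nat.mul_le_mul_right _ hconst
    _ = 5 * (p + q).choose q * p ^ 2 := by ring

/-- `q! ≤ 2^{q·q}`. -/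
theorem factorial_le_two_pow_sq (q : ℕ) : q.factorial ≤ 2 ^ (q * q) := by
  calc q.factorial ≤ q ^ q := Nat.factorial_le_pow q
    _ ≤ (2 ^ q) ^ q := Nat.pow_le_pow_left Nat.lt_two_pow_self.le q
    _ = 2 ^ (q * q) := by rw [← pow_mul]

/-- `(p+1)^q ≤ q!·C(p+q, q)`. -/
theorem pow_le_factorial_mul_choose (p q : ℕ) : (p + 1) ^ q ≤ q.factorial * (p + q).choose q := by
  have h := Nat.pow_sub_le_descFactorial (p + q) q
  rw [show p + q + 1 - q = p + 1 by omega, Nat.descFactorial_eq_factorial_mul_choose] at h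
  exact h

/-- The exponent bookkeeping of the big class: `2^{q+4}·2^{3q+6}·((q+2)·2^{q+2})^{q−2}·2^{q·q} ≤ Tcap q ^ q` (`q ≥ 3`). -/
theorem big_const_le (q : ℕ) (hq : 3 ≤ q) :
    2 ^ (q + 4) * 2 ^ (3 * q + 6) * ((q + 2) * 2 ^ (q + 2)) ^ (q - 2) * 2 ^ (q * q) ≤ Tcap q ^ q := by
  obtain ⟨q', rfl⟩ : ∃ q', q = q' + 2 := ⟨q - 2, by omega⟩
  unfold Tcap
  rw [show q' + 2 - 2 = q' by omega]
  have hL : 2 ^ (q' + 2 + 4) * 2 ^ (3 * (q' + 2) + 6) * ((q' + 2 + 2) * 2 ^ (q' + 2 + 2)) ^ q' *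
      2 ^ ((q' + 2) * (q' + 2)) = (q' + 4) ^ q' * 2 ^ (2 * q' * q' + 12 * q' + 22) := by
    rw [mul_pow, ← pow_mul]
    ring
  have hR : ((q' + 2 + 2) * 2 ^ (2 * (q' + 2) + 6)) ^ (q' + 2) =
      (q' + 4) ^ (q' + 2) * 2 ^ (2 * q' * q' + 14 * q' + 20) := by
    rw [mul_pow, ← pow_mul]
    ring
  rw [hL, hR]
  apply Nat.mul_le_mul
  · exact Nat.pow_le_pow_right (by omega) (by omega)
  · exact Nat.pow_le_pow_right (by norm_num) (by omega)

/-- **The big class**: `2^{q+4}·C(d+q, 3)·C((q+1)d + d + q − 3, q−2) ≤ 5·C(p+q, q)` for `p ≥ Tcap q`. -/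
theorem big_term_bound (q d p : ℕ) (hq : 3 ≤ q) (hd2 : d ≤ q + 2 ^ q) (hp : Tcap q ≤ p) :
    2 ^ (q + 4) * (d + q).choose 3 * (d + q - 3 + (q + 1) * d).choose (q - 2) ≤ 5 * (p + q).choose q := by
  have hX : d + q - 3 + (q + 1) * d ≤ (q + 2) * 2 ^ (q + 2) := by
    have h1 := add_le_two_pow_of_le q d hd2
    calc d + q - 3 + (q + 1) * d ≤ (q + 2) * (d + q) := by
          have : (q + 1) * d ≤ (q + 1) * (d + q) := Nat.mul_le_mul_left _ (by omega)
          have h0 : d + q - 3 ≤ d + q := Nat.sub_le _ _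
          nlinarith
      _ ≤ (q + 2) * 2 ^ (q + 2) := Nat.mul_le_mul_left _ h1
  have hCX : (d + q - 3 + (q + 1) * d).choose (q - 2) ≤ ((q + 2) * 2 ^ (q + 2)) ^ (q - 2) :=
    (Nat.choose_le_pow _ _).trans (Nat.pow_le_pow_left hX _)
  have h3 := choose_three_le q d hd2
  have hfac := factorial_le_two_pow_sq q
  have hpc := pow_le_factorial_mul_choose p q
  have hT : Tcap q ^ q ≤ (p + 1) ^ q := Nat.pow_le_pow_left (by omega) q
  have hbig := big_const_le q hq
  have hqpos : 0 < q.factorial := Nat.factorial_pos q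
  refine Nat.le_of_mul_le_mul_right ?_ hqpos
  calc 2 ^ (q + 4) * (d + q).choose 3 * (d + q - 3 + (q + 1) * d).choose (q - 2) * q.factorial
      ≤ 2 ^ (q + 4) * 2 ^ (3 * q + 6) * ((q + 2) * 2 ^ (q + 2)) ^ (q - 2) * 2 ^ (q * q) := by
        apply Nat.mul_le_mul (Nat.mul_le_mul (Nat.mul_le_mul_left _ h3) hCX) hfac
    _ ≤ Tcap q ^ q := hbig
    _ ≤ (p + 1) ^ q := hT
    _ ≤ q.factorial * (p + q).choose q := hpc
    _ ≤ 5 * (p + q).choose q * q.factorial := by nlinarith [Nat.zero_le (q.factorial * (p + q).choose q)]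

/-- **THE POLYNOMIAL INEQUALITY `(P_d)` WITH THE CAP, AT EVERY CORANK `q + 1 ≤ d ≤ q + 2^q`, FOR `p ≥ Tcap q`.** -/
theorem poly_main_cap (q d p N : ℕ) (hq : 3 ≤ q) (hd1 : q + 1 ≤ d) (hd2 : d ≤ q + 2 ^ q) (hp : Tcap q ≤ p)
    (hN : N ≤ 2 ^ (d - 1) * ((d + q).choose 3 *
      ((d + q - 3 + (p + d)).choose (q - 2) + (d + q - 3 + (q + 1) * d).choose (q - 2)))) :
    8 * ((p + d).choose q + N) ≤ 7 * 2 ^ (d - q) * (p + q).choose q := by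
  obtain ⟨m, rfl⟩ : ∃ m, d = q + 1 + m := ⟨d - (q + 1), by omega⟩
  obtain ⟨-, h16, -, -, -⟩ := Tcap_bounds q hq
  have hratio : 8 * (2 * q * (m + 1)) ≤ p + 1 := by
    have : m + 1 ≤ 2 ^ q := by omega
    calc 8 * (2 * q * (m + 1)) ≤ 8 * (2 * q * 2 ^ q) := by gcongr
      _ = 16 * q * 2 ^ q := by ring
      _ ≤ p + 1 := by omega
  obtain ⟨hr, -⟩ := ratio_bounds q m p hratio
  rw [show p + q + 1 + m = p + (q + 1 + m) by ring] at hr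
  have hS := small_term_bound q (q + 1 + m) p hq (by omega) hd2 hp
  have hB := big_term_bound q (q + 1 + m) p hq hd2 hp
  rw [show 2 ^ (q + 4) = 16 * 2 ^ q by ring] at hS
  rw [show 2 ^ (q + 4) = 16 * 2 ^ q by ring] at hB
  rw [show q + 1 + m - 1 = q + m by omega, pow_add] at hN
  rw [show q + 1 + m - q = m + 1 by omega, pow_succ]
  generalize hE : 2 ^ m = E at hN ⊢
  generalize hX : 2 ^ q = X at hS hB hN
  generalize hC : (p + q).choose q = C at hr hS hB ⊢
  generalize hC3 : (q + 1 + m + q).choose 3 = C3 at hS hB hN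
  generalize hA : (q + 1 + m + q - 3 + (p + (q + 1 + m))).choose (q - 2) = A at hS hN
  generalize hB' : (q + 1 + m + q - 3 + (q + 1) * (q + 1 + m)).choose (q - 2) = B at hB hN
  generalize hCn : (p + (q + 1 + m)).choose q = Cn at hr ⊢
  have hE1 : 1 ≤ E := by rw [← hE]; exact Nat.one_le_two_pow
  have h1 := Nat.mul_le_mul_left E hS
  have h2 := Nat.mul_le_mul_left E hB
  have h3 : C ≤ E * C := Nat.le_mul_of_pos_left _ hE1
  nlinarith [h1, h2, h3, hr, hN]

end Explicit

end ThmN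

end PercRepro
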